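import Literature.MathematicalPhysics.QuantumLattice.DWaveSourceNNNHoppingEnergyDensityExists
import Literature.MathematicalPhysics.QuantumLattice.DWaveSourceLeeYang
import HarnessLib

/-!
# The pair-sourced `t–t'` ground energy is EVEN in the source; the thermodynamic-limit energy density
# `e_src(t', U, μ, ·)` is even, and `d`-wave order at `(t', U, μ)` IS non-differentiability of `e_src` at `0`

Topic `Literature/MathematicalPhysics/QuantumLattice` (family `hubbard`); the `t' ≠ 0` TWIN of
`DWaveSourceGroundEnergyEven.lean` (hubbard-cq row p5, `t' = 0`), written for the Hubbard cuprate cell whose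
PRESENT anchor sits at `t' = −1/4`. The source term `−h(Δ_d + Δ_d†)` of
`A_L(t',U,μ,h) = dWaveSourceTorusTT' L t' U μ h` changes the particle number by `∓2` while the `t–t'` Hamiltonian
and `μN` conserve it, so the gauge rotation `e^{iπN/2}` maps `A_L(h)` to `A_L(−h)`:

* §1 `groundEnergy_dWaveSourceTorusTT'_neg`: `E₀(A_L(t',U,μ,−h)) = E₀(A_L(t',U,μ,h))` (every torus).
* §2 `dWaveSourceEnergyDensityTT'_even`: `e_src(t',U,μ,−h) = e_src(t',U,μ,h)` — UNCONDITIONAL (the limit exists,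
  `tendsto_dWaveSourceEnergyDensityTT'`); so `e_src` is largest at `h = 0` and non-increasing in `|h|`, and
  certified windows transport across the sign of the source.
* §3 THE TWO-SIDED CUSP at `t'`: the right slope of `e_src(t',U,μ,·)` at `0` tends to `−2·m⋆`, the left slope to
  `+2·m⋆` (`m⋆ = dWaveOrderParameterTT' t' U μ`); `HasDerivAt e_src e' 0 ↔ e' = 0 ∧ m⋆ = 0`; hence
  **`HasDWaveOrderTT' t' U μ ↔ ¬ DifferentiableAt ℝ (e_src(t',U,μ,·)) 0`** — the cell's "PC-c = PC-a" identity at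
  the `t'` anchor — and `¬ HasDWaveOrderTT' ↔ HasDerivAt e_src 0 0`.

Everything is PROVED; no definition, no named fact. HONEST SCOPE: nothing here decides whether the order
parameter is positive; these identities say which certified feature of `e_src` would.

## References
* T. Koma, H. Tasaki, J. Stat. Phys. 76 (1994) 745–803, §1 (sourced Hamiltonian; `U(1)` gauge rotations).
  [cite: KomaTasaki1994, §1]
* R. B. Griffiths, Phys. Rev. 152 (1966) 240–246, §II (one-sided derivatives and the order parameter).
  [cite: Griffiths1966, §II]
* H. Xu et al., Science 384 (2024) eadh7691, eq. (1) (the `t–t'` model with a `d`-wave pinning field).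
  [cite: XuEtAl2024, eq. (1) p. 2]
-/

noncomputable section

namespace Literature.MathematicalPhysics.QuantumLattice

open Matrix Filter Set Literature.Probability.LatticeModels HubbardWave0
open scoped Topology

/-! ### Similarity invariance of the ground energy -/

section Similarity

variable {m : Type*} [Fintype m] [DecidableEq m]

/-- `E₀(W A W′) = E₀(A)` whenever `W W′ = 1 = W′ W` (the spectrum is invariant under conjugation by a unit).
[folklore] -/
private theorem groundEnergy_conj_of_mul_eq_one' {A W W' : Matrix m m ℂ} (hWW' : W * W' = 1)
    (hW'W : W' * W = 1) : (W * A * W').groundEnergy = A.groundEnergy := by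
  set u : (Matrix m m ℂ)ˣ := ⟨W, W', hWW', hW'W⟩
  have hspec : spectrum ℂ (W * A * W') = spectrum ℂ A := spectrum.units_conjugate (u := u)
  unfold Matrix.groundEnergy ContinuousLinearMap.groundEnergy
  rw [spectrum_toEuclideanCLM, spectrum_toEuclideanCLM, hspec]

end Similarity

/-! ### §1 Evenness of the sourced `t–t'` ground energy in the source -/

section Even

variable (L : ℕ) [NeZero L]

omit [NeZero L] in
/-- `[N, H^{tt'}_L − μN] = 0`, in diagonal form (the `t–t'` Hamiltonian conserves the particle number).
[cite: KomaTasaki1994, §1] -/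
theorem diagonal_card_commutator_hubbardTorusTT'_sub_mu (tp U μ : ℝ) :
    diagonal (fun s : Finset (Orb (FermionTorus 2 L)) => (s.card : ℂ)) *
        (hubbardTorusTT' L 1 tp U - (μ : ℂ) • totalNumber) -
      (hubbardTorusTT' L 1 tp U - (μ : ℂ) • totalNumber) * diagonal (fun s => (s.card : ℂ)) = 0 := by
  have hcomm : Commute (hubbardTorusTT' L 1 tp U - (μ : ℂ) • totalNumber)
      (totalNumber : Matrix (Finset (Orb (FermionTorus 2 L))) (Finset (Orb (FermionTorus 2 L))) ℂ) :=
    (hubbardTorusTT'_commute_totalNumber L 1 tp U).sub_left ((Commute.refl _).smul_left _)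
  rw [← totalNumber_torus_eq_diagonal]
  exact sub_eq_zero.2 hcomm.eq.symm

/-- **The sourced `t–t'` ground energy is even in the source**:
`E₀(dWaveSourceTorusTT' L t' U μ (−h)) = E₀(dWaveSourceTorusTT' L t' U μ h)` for every real `h` (gauge rotation
`e^{iπN/2}`: it fixes `H^{tt'}_L − μN` and flips the sign of `Δ_d + Δ_d†`, preserving the spectrum).
[cite: KomaTasaki1994, §1] -/
theorem groundEnergy_dWaveSourceTorusTT'_neg (tp U μ h : ℝ) :
    (dWaveSourceTorusTT' L tp U μ (-h)).groundEnergy = (dWaveSourceTorusTT' L tp U μ h).groundEnergy := by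
  set d : Finset (Orb (FermionTorus 2 L)) → ℂ := fun s => (s.card : ℂ) with hd
  set c : ℂ := (Real.pi : ℂ) / 2 * Complex.I with hc
  set W : Matrix (Finset (Orb (FermionTorus 2 L))) (Finset (Orb (FermionTorus 2 L))) ℂ :=
    diagonal fun s => Complex.exp (c * d s) with hW
  set W' : Matrix (Finset (Orb (FermionTorus 2 L))) (Finset (Orb (FermionTorus 2 L))) ℂ :=
    diagonal fun s => Complex.exp (-(c * d s)) with hW'
  have hWW' : W * W' = 1 := diagonal_exp_mul_diagonal_exp_neg d c
  have hW'W : W' * W = 1 := by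
    rw [hW, hW', diagonal_mul_diagonal, ← diagonal_one]
    congr 1
    funext s
    rw [← Complex.exp_add, neg_add_cancel, Complex.exp_zero]
  have hc2 : Complex.exp (c * 2) = -1 := by
    rw [hc, show (Real.pi : ℂ) / 2 * Complex.I * 2 = Real.pi * Complex.I by ring]
    exact Complex.exp_pi_mul_I
  have hcm2 : Complex.exp (c * -2) = -1 := by
    have h1 : Complex.exp (c * -2) * Complex.exp (c * 2) = 1 := by
      rw [← Complex.exp_add]
      ring_nf
      exact Complex.exp_zero
    rw [hc2] at h1
    linear_combination -h1
  -- the rotation fixes `H^{tt'} − μN` …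
  have hcH : W * (hubbardTorusTT' L 1 tp U - (μ : ℂ) • totalNumber) * W' =
      hubbardTorusTT' L 1 tp U - (μ : ℂ) • totalNumber := by
    have key := conj_eq_smul_of_grading d (A := hubbardTorusTT' L 1 tp U - (μ : ℂ) • totalNumber) (q := 0)
      (by simpa using diagonal_card_commutator_hubbardTorusTT'_sub_mu L tp U μ) c
    rw [hW, hW', key]
    simp
  -- … and flips the source `Δ_d + Δ_d†`
  have hcQ : W * (pairField dWaveFormFactor L + (pairField dWaveFormFactor L)ᴴ) * W' =
      -(pairField dWaveFormFactor L + (pairField dWaveFormFactor L)ᴴ) := by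
    rw [hW, hW', Matrix.mul_add, Matrix.add_mul,
      conj_eq_smul_of_grading d (diagonal_card_commutator_pairField L) c,
      conj_eq_smul_of_grading d (diagonal_card_commutator_pairField_conjTranspose L) c, hcm2, hc2,
      neg_one_smul, neg_one_smul, neg_add]
  have hconj : W * dWaveSourceTorusTT' L tp U μ h * W' = dWaveSourceTorusTT' L tp U μ (-h) := by
    unfold dWaveSourceTorusTT'
    rw [Matrix.mul_sub, Matrix.sub_mul, hcH, Matrix.mul_smul, Matrix.smul_mul, hcQ, Complex.ofReal_neg,
      smul_neg, neg_smul]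
  rw [← hconj, groundEnergy_conj_of_mul_eq_one' hWW' hW'W]

end Even

/-! ### §2 The thermodynamic-limit energy density is even in the source -/

section Limit

variable (t' U μ : ℝ)

/-- **`e_src(t',U,μ,−h) = e_src(t',U,μ,h)`** for every real `h` (unconditional: the limit exists at every real
source). [cite: KomaTasaki1994, §1] -/
theorem dWaveSourceEnergyDensityTT'_even (h : ℝ) :
    dWaveSourceEnergyDensityTT' t' U μ (-h) = dWaveSourceEnergyDensityTT' t' U μ h := by
  refine tendsto_nhds_unique (tendsto_dWaveSourceEnergyDensityTT' t' U μ (-h)) ?_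
  simp only [groundEnergy_dWaveSourceTorusTT'_neg]
  exact tendsto_dWaveSourceEnergyDensityTT' t' U μ h

/-- **`e_src` is non-increasing in `|h|`**: `|h| ≤ |h'| ⇒ e_src(h') ≤ e_src(h)` (even, and non-increasing on
`[0, ∞)`). [cite: KomaTasaki1994, §1] -/
theorem dWaveSourceEnergyDensityTT'_anti_abs {h h' : ℝ} (hle : |h| ≤ |h'|) :
    dWaveSourceEnergyDensityTT' t' U μ h' ≤ dWaveSourceEnergyDensityTT' t' U μ h := by
  have key : ∀ x : ℝ, dWaveSourceEnergyDensityTT' t' U μ x = dWaveSourceEnergyDensityTT' t' U μ |x| := by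
    intro x
    rcases le_total 0 x with hx | hx
    · rw [abs_of_nonneg hx]
    · rw [abs_of_nonpos hx, dWaveSourceEnergyDensityTT'_even]
  rw [key h, key h']
  exact dWaveSourceEnergyDensityTT'_anti t' U μ (abs_nonneg h) hle

/-- **Window transport across the sign of the source, floor**: `lo ≤ e_src(h) ⇒ lo ≤ e_src(−h)`.
[cite: KomaTasaki1994, §1] -/
theorem dWaveSourceEnergyDensityTT'_neg_ge_of_ge {h lo : ℝ} (hlo : lo ≤ dWaveSourceEnergyDensityTT' t' U μ h) :
    lo ≤ dWaveSourceEnergyDensityTT' t' U μ (-h) := by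
  rwa [dWaveSourceEnergyDensityTT'_even]

/-- **Window transport across the sign of the source, ceiling**: `e_src(h) ≤ hi ⇒ e_src(−h) ≤ hi`.
[cite: KomaTasaki1994, §1] -/
theorem dWaveSourceEnergyDensityTT'_neg_le_of_le {h hi : ℝ} (hhi : dWaveSourceEnergyDensityTT' t' U μ h ≤ hi) :
    dWaveSourceEnergyDensityTT' t' U μ (-h) ≤ hi := by
  rwa [dWaveSourceEnergyDensityTT'_even]

end Limit

/-! ### §3 The two-sided cusp: order = non-differentiability of `e_src(t',U,μ,·)` at zero source -/

section TwoSided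

variable (t' U μ : ℝ)

/-- The RIGHT slope of `e_src(t',U,μ,·)` at `0` tends to `−2·dWaveOrderParameterTT' t' U μ` (the cusp identity).
[cite: Griffiths1966, §II] -/
theorem tendsto_slope_dWaveSourceEnergyDensityTT'_nhdsGT_zero :
    Tendsto (slope (dWaveSourceEnergyDensityTT' t' U μ) 0) (𝓝[>] 0)
      (𝓝 (-2 * dWaveOrderParameterTT' t' U μ)) := by
  have key := (tendsto_slope_nhdsGT_dWaveOrderParameterTT' t' U μ
    (fun h _ => tendsto_dWaveSourceEnergyDensityTT' t' U μ h)).const_mul (-2)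
  refine key.congr' ?_
  filter_upwards [self_mem_nhdsWithin] with h hh
  have hh' : (0 : ℝ) < h := hh
  rw [slope_def_field, sub_zero]
  field_simp
  ring

/-- The LEFT slope of `e_src(t',U,μ,·)` at `0` tends to `+2·dWaveOrderParameterTT' t' U μ` (evenness).
[cite: Griffiths1966, §II] -/
theorem tendsto_slope_dWaveSourceEnergyDensityTT'_nhdsLT_zero :
    Tendsto (slope (dWaveSourceEnergyDensityTT' t' U μ) 0) (𝓝[<] 0)
      (𝓝 (2 * dWaveOrderParameterTT' t' U μ)) := by
  have hneg : Tendsto (fun h : ℝ => -h) (𝓝[<] (0 : ℝ)) (𝓝[>] (0 : ℝ)) := by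
    simpa using (tendsto_neg_nhdsLT (a := (0 : ℝ)))
  have key := ((tendsto_slope_nhdsGT_dWaveOrderParameterTT' t' U μ
    (fun h _ => tendsto_dWaveSourceEnergyDensityTT' t' U μ h)).comp hneg).const_mul 2
  refine key.congr' ?_
  filter_upwards [self_mem_nhdsWithin] with h hh
  have hh' : h < 0 := hh
  have hne : h ≠ 0 := hh'.ne
  rw [slope_def_field, sub_zero, Function.comp_apply, dWaveSourceEnergyDensityTT'_even t' U μ h]
  field_simp
  ring

/-- **Differentiability at zero source = no order**:
`HasDerivAt (e_src(t',U,μ,·)) e′ 0 ↔ e′ = 0 ∧ dWaveOrderParameterTT' t' U μ = 0`. [cite: Griffiths1966, §II] -/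
theorem hasDerivAt_dWaveSourceEnergyDensityTT'_zero_iff {e' : ℝ} :
    HasDerivAt (dWaveSourceEnergyDensityTT' t' U μ) e' 0 ↔ e' = 0 ∧ dWaveOrderParameterTT' t' U μ = 0 := by
  have hL := tendsto_slope_dWaveSourceEnergyDensityTT'_nhdsLT_zero t' U μ
  have hR := tendsto_slope_dWaveSourceEnergyDensityTT'_nhdsGT_zero t' U μ
  rw [hasDerivAt_iff_tendsto_slope_left_right]
  constructor
  · rintro ⟨hl, hr⟩
    have h1 := tendsto_nhds_unique hl hL
    have h2 := tendsto_nhds_unique hr hR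
    constructor <;> linarith
  · rintro ⟨rfl, h0⟩
    rw [h0, mul_zero] at hL hR
    exact ⟨hL, hR⟩

/-- **`d`-wave order at `(t', U, μ)` IS non-differentiability of the sourced energy density at zero source**
(the literal form of "PC-c = PC-a" at the `t'` anchor, unconditional):
`HasDWaveOrderTT' t' U μ ↔ ¬ DifferentiableAt ℝ (dWaveSourceEnergyDensityTT' t' U μ) 0`. [cite: KomaTasaki1994, §1] -/
theorem hasDWaveOrderTT'_iff_not_differentiableAt_dWaveSourceEnergyDensityTT' :
    HasDWaveOrderTT' t' U μ ↔ ¬ DifferentiableAt ℝ (dWaveSourceEnergyDensityTT' t' U μ) 0 := by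
  unfold HasDWaveOrderTT'
  constructor
  · intro hpos hd
    have h0 := ((hasDerivAt_dWaveSourceEnergyDensityTT'_zero_iff t' U μ).1 hd.hasDerivAt).2
    exact hpos.ne' h0
  · intro hnd
    rcases (dWaveOrderParameterTT'_nonneg t' U μ).eq_or_lt with h0 | hpos
    · exact absurd ((hasDerivAt_dWaveSourceEnergyDensityTT'_zero_iff t' U μ).2 ⟨rfl, h0.symm⟩).differentiableAt hnd
    · exact hpos

/-- Equivalently: NO `d`-wave order at `(t', U, μ)` iff `e_src(t',U,μ,·)` is differentiable at zero source — and
then the derivative there is `0`. [cite: KomaTasaki1994, §1] -/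
theorem not_hasDWaveOrderTT'_iff_hasDerivAt_dWaveSourceEnergyDensityTT'_zero :
    ¬ HasDWaveOrderTT' t' U μ ↔ HasDerivAt (dWaveSourceEnergyDensityTT' t' U μ) 0 0 := by
  rw [hasDerivAt_dWaveSourceEnergyDensityTT'_zero_iff t' U μ]
  unfold HasDWaveOrderTT'
  rw [not_lt]
  constructor
  · intro hle
    exact ⟨rfl, le_antisymm hle (dWaveOrderParameterTT'_nonneg t' U μ)⟩
  · rintro ⟨-, h0⟩
    exact h0.le

/-- **A certified symmetric CHORD through zero source bounds the order parameter from above**: for `h > 0`,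
`dWaveOrderParameterTT' t' U μ ≤ (e_src(−h) − e_src(h))·0 + (e_src(0) − e_src(h))/(2h)` — restated with the even
partner: `m⋆ ≤ (e_src(0) − e_src(−h))/(2h)`, so a window at a NEGATIVE source is as good as one at `+h`.
[cite: KomaTasaki1994, §1] -/
theorem dWaveOrderParameterTT'_le_slope_energyDensity_neg {h : ℝ} (hh : 0 < h) :
    dWaveOrderParameterTT' t' U μ ≤
      (dWaveSourceEnergyDensityTT' t' U μ 0 - dWaveSourceEnergyDensityTT' t' U μ (-h)) / (2 * h) := by
  rw [dWaveSourceEnergyDensityTT'_even]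
  exact dWaveOrderParameterTT'_le_slope_energyDensity t' U μ hh

end TwoSided

end Literature.MathematicalPhysics.QuantumLattice

end
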